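import Mathlib
import Summits.Langlands.Langlands.Theses.QuadraticWindow
import HarnessLib

/-!
# Crux stmt-Langlands-15138, line Sketch, stub `stub_multiset_eq_of_add_map_mul_eq`: q-difference rigidity of complex multisets

The combinatorial core of comparing two Euler factors at one place: if two finite multisets
`A`, `B` of non-zero complex numbers satisfy `B + q•A = A + q•B` (where `q•X` is the image
multiset `X.map (q * ·)`) and `‖q‖ ≠ 1`, then `B = A`.

Proof: for `q = 0` both images are `replicate _ 0`; counting `0` gives `card A = card B` and we
cancel.  For `q ≠ 0` the integer-valued difference `D x = count x B - count x A` satisfies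
`D (q * x) = D x` (count `q * x` on both sides, `(q * ·)` being injective), hence
`D (q ^ k * x) = D x` for all `k`.  If `B ≠ A`, some `x` has `D x ≠ 0`; then every `q ^ k * x`
lies in the finite set of members of `A + B`, `x ≠ 0` (as `0 ∉ A + B`), and `k ↦ q ^ k * x` is
injective (norms `‖q‖ ^ k * ‖x‖` with `0 < ‖q‖ ≠ 1`), contradicting finiteness.  Pure Mathlib.
-/

set_option linter.dupNamespace false

namespace Summit.Langlands.Langlands.Theorems.AutomorphicInductionUnramified.Sketch

/-- For `q ≠ 0`, counting `q * x` on both sides of `B + q•A = A + q•B` shows that the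
integer-valued difference `count · B - count · A` is invariant under `x ↦ q * x`. -/
private lemma count_sub_count_mul_eq {q : ℂ} (hq0 : q ≠ 0) {A B : Multiset ℂ}
    (h : B + A.map (q * ·) = A + B.map (q * ·)) (x : ℂ) :
    ((B.count (q * x) : ℤ) - A.count (q * x)) = (B.count x : ℤ) - A.count x := by
  have hinj : Function.Injective (fun y : ℂ => q * y) := mul_right_injective₀ hq0
  have hc := congr_arg (Multiset.count (q * x)) h
  rw [Multiset.count_add, Multiset.count_add, Multiset.count_map_eq_count' _ _ hinj,
    Multiset.count_map_eq_count' _ _ hinj] at hc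
  omega

/-- Iterating `count_sub_count_mul_eq`: the difference `count · B - count · A` is invariant under
`x ↦ q ^ k * x` for every `k : ℕ` (for `q ≠ 0`). -/
private lemma count_sub_count_pow_mul_eq {q : ℂ} (hq0 : q ≠ 0) {A B : Multiset ℂ}
    (h : B + A.map (q * ·) = A + B.map (q * ·)) (x : ℂ) (k : ℕ) :
    ((B.count (q ^ k * x) : ℤ) - A.count (q ^ k * x)) = (B.count x : ℤ) - A.count x := by
  induction k with
  | zero => simp
  | succ k ih => rw [pow_succ', mul_assoc, count_sub_count_mul_eq hq0 h, ih]

/-- **q-difference rigidity of complex multisets.**  If `A`, `B` are finite multisets of complex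
numbers with `0 ∉ A + B`, `‖q‖ ≠ 1`, and `B + A.map (q * ·) = A + B.map (q * ·)`, then `B = A`.
(For `q = 0` count `0`; for `q ≠ 0` the difference of count functions is invariant under
multiplication by `q`, and a non-zero value would give infinitely many members `q ^ k * x` of
`A + B`.) -/
theorem stub_multiset_eq_of_add_map_mul_eq {q : ℂ} (hq : ‖q‖ ≠ 1) (A B : Multiset ℂ)
    (h0 : (0 : ℂ) ∉ A + B) (h : B + A.map (q * ·) = A + B.map (q * ·)) : B = A := by
  rcases eq_or_ne q 0 with rfl | hq0
  · -- `q = 0`: both images are `replicate _ 0`; count `0` to get `card A = card B`, then cancel.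
    simp only [zero_mul, Multiset.map_const'] at h
    rw [Multiset.mem_add, not_or] at h0
    have hc := congr_arg (Multiset.count (0 : ℂ)) h
    rw [Multiset.count_add, Multiset.count_add, Multiset.count_replicate_self,
      Multiset.count_replicate_self, Multiset.count_eq_zero_of_notMem h0.1,
      Multiset.count_eq_zero_of_notMem h0.2, zero_add, zero_add] at hc
    rw [hc] at h
    exact add_right_cancel h
  · -- `q ≠ 0`: the difference of counts is `(q * ·)`-invariant; a non-zero value is impossible.
    by_contra hne
    obtain ⟨x, hx⟩ := not_forall.mp (mt Multiset.ext' hne)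
    have hD : ((B.count x : ℤ) - A.count x) ≠ 0 := sub_ne_zero.mpr (by exact_mod_cast hx)
    -- every `q ^ k * x` is a member of `A + B`
    have hmem : ∀ k : ℕ, q ^ k * x ∈ {y : ℂ | y ∈ A + B} := by
      intro k
      have hk : ((B.count (q ^ k * x) : ℤ) - A.count (q ^ k * x)) ≠ 0 := by
        rwa [count_sub_count_pow_mul_eq hq0 h x k]
      rw [Set.mem_setOf_eq, Multiset.mem_add]
      by_contra hnot
      rw [not_or] at hnot
      rw [Multiset.count_eq_zero_of_notMem hnot.2, Multiset.count_eq_zero_of_notMem hnot.1,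
        Nat.cast_zero, sub_zero] at hk
      exact hk rfl
    have hx0 : x ≠ 0 := by
      rintro rfl
      exact h0 (by simpa using hmem 0)
    have hinj : Function.Injective (fun k : ℕ => q ^ k * x) := by
      intro j k hjk
      have hq' : q ^ j = q ^ k := mul_right_cancel₀ hx0 hjk
      have hn : ‖q‖ ^ j = ‖q‖ ^ k := by rw [← norm_pow, ← norm_pow, hq']
      exact pow_right_injective₀ (norm_pos_iff.mpr hq0) hq hn
    exact Set.infinite_of_injective_forall_mem hinj hmem (Multiset.finite_toSet (A + B))

end Summit.Langlands.Langlands.Theorems.AutomorphicInductionUnramified.Sketch
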